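import Mathlib
import HarnessLib

/-!
# Enflo 2023, v2 Lemma 1 (pp.8–9): every number reproduced; the printed inference (24) isolated and repaired

Source under adjudication: Per H. Enflo, *On the invariant subspace problem in Hilbert spaces*, arXiv:2305.15442 (v1
2023, v2 2024), bib key `Enflo2023` — a CLAIMED proof of the invariant subspace problem for operators on a separable
Hilbert space.  This file is part of the kernel-tight typing of the manuscript by the b2b-enflo repair cell
(formaliser 1, Part A: v2 eq. (1)–(27), the set-up, the constructions `V_y`, `ℓ'`, `[ ]x₀`, Lemma 1 and Case I/II of
the main step).  It records what FOLLOWS (proved implications from the manuscript's displayed hypotheses) and, where a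
step does not follow, the typed inference together with its refutation.  NOTHING here asserts that the manuscript's
main theorem holds; no declaration concludes the invariant subspace problem for an arbitrary operator.  Value
(BLOCK-2b): theorems / refutations of typed inferences about a text — not progress on the problem.

LEMMA 1 (v2 pp.8–9, tex:L296–L320) — every number reproduced (tag b2b), and the printed inference at (24) isolated.

Setting of Lemma 1: `x₀ = (√3/2)u₀ + (1/2)u₁`, `y'₀ = (√3/2)u₀`, `‖T‖ = 10^{-20}`, window `ε ∈ (1/2 − w, 1/2]` with
`w = 10^{-5}(εθ)_0`, claim: some `ε` in the window has `εθ ≤ w/2`.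
The proof's chain:  (i) if `‖x₀ − Σ a_j T^j y'₀‖ ≤ 1/2 − w` then the `u₁`-component forces `|Σ_{j≥1} a_j⟨T^j y'₀,u₁⟩| ≥ w`
(`window_forces_tail` below: `‖1/2 − s‖ ≤ 1/2 − w ⇒ ‖s‖ ≥ w`);  (ii) hence `sup_j |a_j| ≥ w / Σ_j |⟨T^j y'₀, u₁⟩|`
(`coeff_lower_bound`);  (iii) (10): scaling `ℓ' ↦ (1+δ)ℓ'` lowers the radius by `δ·εθ/10 ≥ δw/20` at cost factor `1+δ`
(`norm_sub_add_smul_sq`, `eq10_radius`);  (iv) iterating from `ε = 1/2` down to `1/2 − w` costs at most `(1+δ)^{⌈20/δ⌉} ≤ e^{20}(1+δ)`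
(`iterate_bound`, `growth_le`);  (v) contradiction iff the bound in (ii) exceeds `e^{20}(1+δ)·‖ℓ'_{1/2}‖₂`, `‖ℓ'_{1/2}‖₂ ≤ 1`.
THE PRINTED (24): "`max_{j≥1}|a_j| ≥ 10^{20−5−1} = 10^{14}`".  What (ii) gives depends on the bound used for `g_j := |⟨T^j y'₀,u₁⟩|`:
 (A) `g_j ≤ ‖T‖^j ‖y'₀‖ = (√3/2)10^{-20j}`            ⇒ `sup|a_j| ≥ (2/√3)(1 − 10^{-20})·10^{15}·(εθ)_0`  — the factor `(εθ)_0` is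
     missing in print; contradiction with (iv) iff `(εθ)_0 > e^{20}(√3/2)10^{-15}/(1−10^{-20}) ≈ 4.2×10^{-7}` (`readingA_threshold`);
 (B) the paper's own choice `‖T*u₁‖ < (εθ)_0` (tex:L263): `g_j ≤ (√3/2)10^{-20(j−1)}(εθ)_0` ⇒ `sup|a_j| ≥ (2/√3)(1−10^{-20})10^{-5}` only —
     `(εθ)_0` cancels, no contradiction at all (`readingB_no_contradiction`);
 (C) the referee's sharpening `‖T*u₁‖ ≤ 10^{-19}(εθ)_0`: `sup|a_j| ≥ (2/√3)(1−10^{-20})10^{14} > e^{20}·(1+δ)` for `δ ≤ 10^{-3}` —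
     Lemma 1 goes through for EVERY `(εθ)_0 > 0` (`readingC_contradiction`).  So (24) is a SLIP, repaired by (C).
Step count: (10) as printed yields `20/δ` steps (not `10/δ`); harmless: `e^{20} < 4.86×10^8 < 10^{10}` (`exp_twenty_lt`).
Origin: planner-b2b-enflo-1-0, 2026-08-18.  Mathlib only.
-/

noncomputable section

open scoped InnerProductSpace

namespace Literature.Analysis.OperatorTheory.Enflo2023

namespace Lemma1

/-! ### (i) the window forces a tail component -/

/-- If `‖1/2 − s‖ ≤ 1/2 − w` then `‖s‖ ≥ w` (the `u₁`-coordinate of `x₀ − Σ a_j T^j y'₀` is `1/2 − s`,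
`s = Σ_{j≥1} a_j ⟨T^j y'₀, u₁⟩`, and it is at most the whole norm). [cite: Enflo2023, v2 p.9, proof of Lemma 1] -/
theorem window_forces_tail {s : ℂ} {w : ℝ} (h : ‖(1 / 2 : ℂ) - s‖ ≤ 1 / 2 - w) : w ≤ ‖s‖ := by
  have h1 : ‖(1 / 2 : ℂ)‖ ≤ ‖(1 / 2 : ℂ) - s‖ + ‖s‖ := by
    calc ‖(1 / 2 : ℂ)‖ = ‖((1 / 2 : ℂ) - s) + s‖ := by rw [sub_add_cancel]
      _ ≤ ‖(1 / 2 : ℂ) - s‖ + ‖s‖ := norm_add_le _ _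
  have h2 : ‖(1 / 2 : ℂ)‖ = 1 / 2 := by norm_num
  linarith

/-- A coordinate is bounded by the norm: `|⟪u, v⟫| ≤ ‖v‖` for a unit vector `u`. [folklore] -/
theorem norm_inner_le_of_unit {F : Type*} [NormedAddCommGroup F] [InnerProductSpace ℂ F]
    {u : F} (hu : ‖u‖ = 1) (v : F) : ‖⟪u, v⟫_ℂ‖ ≤ ‖v‖ := by
  have := norm_inner_le_norm (𝕜 := ℂ) u v
  rwa [hu, one_mul] at this

/-! ### (ii) from a tail component to a large coefficient -/

/-- If `w ≤ ‖Σ_j a_j g_j‖` (a finite or convergent sum, here any finset) and `|a_j| ≤ M`, then `w ≤ M · Σ_j ‖g_j‖`.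
Used contrapositively: `sup_j |a_j| ≥ w / Σ_j ‖g_j‖`. [cite: Enflo2023, v2 p.9, proof of Lemma 1] -/
theorem coeff_lower_bound {ι : Type*} (S : Finset ι) (a g : ι → ℂ) {w M : ℝ}
    (hw : w ≤ ‖∑ j ∈ S, a j * g j‖) (hM : ∀ j ∈ S, ‖a j‖ ≤ M) :
    w ≤ M * ∑ j ∈ S, ‖g j‖ := by
  calc w ≤ ‖∑ j ∈ S, a j * g j‖ := hw
    _ ≤ ∑ j ∈ S, ‖a j * g j‖ := norm_sum_le _ _
    _ = ∑ j ∈ S, ‖a j‖ * ‖g j‖ := by simp_rw [norm_mul]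
    _ ≤ ∑ j ∈ S, M * ‖g j‖ := by
        apply Finset.sum_le_sum
        intro j hj
        exact mul_le_mul_of_nonneg_right (hM j hj) (norm_nonneg _)
    _ = M * ∑ j ∈ S, ‖g j‖ := by rw [Finset.mul_sum]

/-- The geometric majorant of `Σ_{j≥1} q^j`, `0 ≤ q < 1`: every partial sum is `≤ q/(1−q)`. [folklore] -/
theorem geom_tail_le {q : ℝ} (hq0 : 0 ≤ q) (hq1 : q < 1) (n : ℕ) :
    ∑ j ∈ Finset.range n, q ^ (j + 1) ≤ q / (1 - q) := by
  have h1 : ∑ j ∈ Finset.range n, q ^ (j + 1) = q * ∑ j ∈ Finset.range n, q ^ j := by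
    rw [Finset.mul_sum]; congr 1; ext j; ring
  rw [h1]
  have h2 : ∑ j ∈ Finset.range n, q ^ j ≤ (1 - q)⁻¹ := by
    have hgeom : ∑ j ∈ Finset.range n, q ^ j = (1 - q ^ n) / (1 - q) := by
      rw [geom_sum_eq hq1.ne, ← neg_sub 1 (q ^ n), ← neg_sub 1 q, neg_div_neg_eq]
    rw [hgeom, div_le_iff₀ (by linarith : 0 < 1 - q), inv_mul_cancel₀ (by linarith)]
    linarith [pow_nonneg hq0 n]
  calc q * ∑ j ∈ Finset.range n, q ^ j ≤ q * (1 - q)⁻¹ := by gcongr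
    _ = q / (1 - q) := by rw [div_eq_mul_inv]

/-! ### (iii) the scaling step (10) -/

/-- `‖x₀ − (1+δ)v‖² = ‖x₀ − v‖² − 2δ·Re⟪x₀ − v, v⟫ + δ²‖v‖²` (the identity behind (10); `Re⟪x₀ − v, v⟫ = εθ`). [folklore] -/
theorem norm_sub_add_smul_sq {F : Type*} [NormedAddCommGroup F] [InnerProductSpace ℂ F] (x₀ v : F) (δ : ℝ) :
    ‖x₀ - ((1 + δ : ℝ) : ℂ) • v‖ ^ 2 = ‖x₀ - v‖ ^ 2 - 2 * δ * (⟪x₀ - v, v⟫_ℂ).re + δ ^ 2 * ‖v‖ ^ 2 := by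
  have : x₀ - ((1 + δ : ℝ) : ℂ) • v = (x₀ - v) - (δ : ℂ) • v := by
    push_cast; rw [add_smul, one_smul]; abel
  rw [this, @norm_sub_sq ℂ, inner_smul_right, norm_smul]
  simp only [RCLike.re_to_complex, Complex.re_ofReal_mul, Complex.norm_real, Real.norm_eq_abs, mul_pow, sq_abs]
  ring

/-- (10), radius form: if `0 ≤ δ`, `0 ≤ εθ`, `δ‖v‖² ≤ 1.86·εθ` and `ε ≤ 0.7`, then
`ε² − 2δεθ + δ²‖v‖² ≤ (ε − δεθ/10)²` — so `(1+δ)ℓ'` is feasible at radius `ε − δεθ/10` (no lower bound on `ε` is needed). [cite: Enflo2023, v2 p.4, eq. (10)] -/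
theorem eq10_radius {ε θ Y δ : ℝ} (hδ : 0 ≤ δ) (hθ : 0 ≤ θ) (hY : δ * Y ≤ 1.86 * θ) (hε : ε ≤ 0.7) :
    ε ^ 2 - 2 * δ * θ + δ ^ 2 * Y ≤ (ε - δ * θ / 10) ^ 2 := by
  nlinarith [mul_nonneg hδ hθ, sq_nonneg (δ * θ)]

/-! ### (iv) iteration and growth -/

/-- Finite descent: if `N(ε − s) ≤ (1+δ)·N(ε)` for every `ε` in the window `(β − w, β]`, then after `k` steps of size `s`
(as long as the starting points stay in the window) `N(β − k s) ≤ (1+δ)^k N(β)`. [folklore] -/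
theorem iterate_bound (N : ℝ → ℝ) {β w s δ : ℝ} (hs : 0 < s) (hδ : 0 ≤ δ)
    (hstep : ∀ ε, β - w < ε → ε ≤ β → N (ε - s) ≤ (1 + δ) * N ε) :
    ∀ k : ℕ, ((k : ℝ) - 1) * s < w → N (β - k * s) ≤ (1 + δ) ^ k * N β := by
  intro k
  induction k with
  | zero => intro _; simp
  | succ k ih =>
      intro hk
      have hk' : ((k : ℝ) - 1) * s < w := by
        have : ((k : ℝ) - 1) * s ≤ ((k + 1 : ℕ) - 1 : ℝ) * s := by
          push_cast; nlinarith
        exact lt_of_le_of_lt this hk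
      have h1 := ih hk'
      have hwin : β - w < β - k * s := by
        push_cast at hk
        nlinarith
      have hle : β - k * s ≤ β := by
        have : (0 : ℝ) ≤ k * s := by positivity
        linarith
      have h2 := hstep (β - k * s) hwin hle
      have h3 : β - ((k + 1 : ℕ) : ℝ) * s = β - k * s - s := by push_cast; ring
      rw [h3, pow_succ]
      calc N (β - k * s - s) ≤ (1 + δ) * N (β - k * s) := h2
        _ ≤ (1 + δ) * ((1 + δ) ^ k * N β) := by gcongr
        _ = (1 + δ) ^ k * (1 + δ) * N β := by ring

/-- `(1+δ)^k ≤ exp(kδ)`. [folklore] -/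
theorem growth_le {δ : ℝ} (hδ : 0 ≤ δ) (k : ℕ) : (1 + δ) ^ k ≤ Real.exp (k * δ) := by
  have h1 : 1 + δ ≤ Real.exp δ := by have := Real.add_one_le_exp δ; linarith
  calc (1 + δ) ^ k ≤ (Real.exp δ) ^ k := pow_le_pow_left₀ (by linarith) h1 k
    _ = Real.exp (k * δ) := by rw [← Real.exp_nat_mul]

/-- With `k = ⌈20/δ⌉` steps (`(k−1)δ < 20 ≤ kδ`): `(1+δ)^k ≤ e^{20}·e^{δ}`. [folklore] -/
theorem growth_twenty {δ : ℝ} (hδ : 0 < δ) (k : ℕ) (hk : ((k : ℝ) - 1) * δ < 20) :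
    (1 + δ) ^ k ≤ Real.exp 20 * Real.exp δ := by
  have h := growth_le hδ.le k
  rw [← Real.exp_add]
  refine h.trans (Real.exp_le_exp.2 ?_)
  nlinarith

/-- `e^{20} < 4.86 × 10^8` (hence `< 10^{10}` as the paper says), from `e < 2.7182818286`. [folklore] -/
theorem exp_twenty_lt : Real.exp 20 < 4.86e8 := by
  have h1 : Real.exp 20 = (Real.exp 1) ^ 20 := by rw [← Real.exp_nat_mul]; norm_num
  rw [h1]
  have h2 := Real.exp_one_lt_d9
  have h3 : (0 : ℝ) ≤ Real.exp 1 := (Real.exp_pos 1).le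
  calc (Real.exp 1) ^ 20 ≤ (2.7182818286 : ℝ) ^ 20 := pow_le_pow_left₀ h3 h2.le 20
    _ < 4.86e8 := by norm_num

/-- `e^{20} > 4.85 × 10^8`, from `e > 2.7182818283`. [folklore] -/
theorem exp_twenty_gt : 4.85e8 < Real.exp 20 := by
  have h1 : Real.exp 20 = (Real.exp 1) ^ 20 := by rw [← Real.exp_nat_mul]; norm_num
  rw [h1]
  have h2 := Real.exp_one_gt_d9
  calc (4.85e8 : ℝ) < (2.7182818283 : ℝ) ^ 20 := by norm_num
    _ ≤ (Real.exp 1) ^ 20 := pow_le_pow_left₀ (by norm_num) h2.le 20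

/-- `e^{20} < 10^{10}`: the slack that absorbs the factor-2 step-count slip of (10) (`20/δ` steps, not `10/δ`). [folklore] -/
theorem exp_twenty_lt_ten_pow_ten : Real.exp 20 < 1e10 := exp_twenty_lt.trans (by norm_num)

/-- `√3/2 ∈ (0.8660254037, 0.8660254038)`. [folklore] -/
theorem sqrt3_half_bounds : 0.8660254037 < Real.sqrt 3 / 2 ∧ Real.sqrt 3 / 2 < 0.8660254038 := by
  constructor
  · have : (1.7320508074 : ℝ) < Real.sqrt 3 := by
      rw [show (1.7320508074 : ℝ) = Real.sqrt (1.7320508074 ^ 2) by rw [Real.sqrt_sq (by norm_num)]]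
      exact Real.sqrt_lt_sqrt (by norm_num) (by norm_num)
    linarith
  · have : Real.sqrt 3 < 1.7320508076 := by
      rw [show (1.7320508076 : ℝ) = Real.sqrt (1.7320508076 ^ 2) by rw [Real.sqrt_sq (by norm_num)]]
      exact Real.sqrt_lt_sqrt (by norm_num) (by norm_num)
    linarith

/-! ### (v) the three readings of (24) — numerals written as `1/10^k` -/

/-- `e^{20}·(√3/2) ∈ (4.2×10^8, 4.209×10^8)`. [folklore] -/
theorem exp20_sqrt3half_lt : Real.exp 20 * (Real.sqrt 3 / 2) < 4.209e8 := by
  obtain ⟨hl, hu⟩ := sqrt3_half_bounds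
  have hE := exp_twenty_lt
  have hE0 := Real.exp_pos 20
  have h1 : Real.exp 20 * (Real.sqrt 3 / 2) < Real.exp 20 * 0.8660254038 := mul_lt_mul_of_pos_left hu hE0
  nlinarith

/-- Numeric lower bound `4.2·10⁸ < e^{20}·(√3/2)` (the reading-(A) threshold constant from below). [folklore] -/
theorem exp20_sqrt3half_gt : 4.2e8 < Real.exp 20 * (Real.sqrt 3 / 2) := by
  obtain ⟨hl, hu⟩ := sqrt3_half_bounds
  have hE' := exp_twenty_gt
  have h1 : 4.85e8 * (Real.sqrt 3 / 2) < Real.exp 20 * (Real.sqrt 3 / 2) :=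
    mul_lt_mul_of_pos_right hE' (by linarith)
  nlinarith

/-- The success criterion of Lemma 1's final comparison.  From (ii) `w ≤ (sup|a_j|)·G` and from (iv)
`sup|a_j| ≤ ‖ℓ'_{1/2−w}‖₂ ≤ e^{20}(1+δ)·‖ℓ'_{1/2}‖₂ ≤ e^{20}(1+δ)`, a contradiction arises iff `w > e^{20}(1+δ)·G`,
where `w = 10^{-5}(εθ)_0` and `G = Σ_{j≥1} g_j`, `g_j ≥ |⟨T^j y'₀, u₁⟩|`.  The three readings differ only in `G`
(all carry the geometric factor `1/(1 − 10^{-20})`, cleared below by multiplying through). [cite: Enflo2023, v2 pp.8–9, Lemma 1, eq. (24)] -/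
def succeeds (e0 δ G : ℝ) : Prop := Real.exp 20 * (1 + δ) * G < (1 / 10 ^ 5) * e0

/-- READING (A): `G·(1 − 10^{-20}) = (√3/2)·10^{-20}`.  Lemma 1 SUCCEEDS at `(εθ)_0 = 4.3×10^{-7}` (every `δ ≤ 10^{-3}`)… [cite: Enflo2023, v2 pp.8–9, Lemma 1, eq. (24)] -/
theorem readingA_succeeds_at {δ : ℝ} (hδ0 : 0 ≤ δ) (hδ1 : δ ≤ 1 / 10 ^ 3) :
    Real.exp 20 * (1 + δ) * ((Real.sqrt 3 / 2) * (1 / 10 ^ 20))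
      < (1 / 10 ^ 5) * (4.3 / 10 ^ 7) * (1 - 1 / 10 ^ 20) := by
  have h := exp20_sqrt3half_lt
  have hpos : 0 < Real.exp 20 * (Real.sqrt 3 / 2) := by linarith [exp20_sqrt3half_gt]
  have h2 : Real.exp 20 * (1 + δ) * ((Real.sqrt 3 / 2) * (1 / 10 ^ 20))
      = (Real.exp 20 * (Real.sqrt 3 / 2)) * (1 + δ) * (1 / 10 ^ 20) := by ring
  rw [h2]
  have h3 : (Real.exp 20 * (Real.sqrt 3 / 2)) * (1 + δ) ≤ 4.209e8 * (1 + 1 / 10 ^ 3) := by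
    have := mul_le_mul h.le (by linarith : 1 + δ ≤ 1 + 1 / 10 ^ 3) (by linarith) (by norm_num)
    exact this
  nlinarith

/-- … and FAILS at `(εθ)_0 = 4.2×10^{-7}` (already for `δ = 0`): the factor `(εθ)_0` dropped in print is decisive. [cite: Enflo2023, v2 pp.8–9, Lemma 1, eq. (24)] -/
theorem readingA_fails_at :
    (1 / 10 ^ 5) * (4.2 / 10 ^ 7) * (1 - 1 / 10 ^ 20)
      < Real.exp 20 * (1 + 0) * ((Real.sqrt 3 / 2) * (1 / 10 ^ 20)) := by
  have h := exp20_sqrt3half_gt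
  nlinarith

/-- READING (A), what the printed `10^{14}` would need: `w/G ≥ 10^{14}` forces `(εθ)_0 ≥ 0.0866`; for `(εθ)_0 ≤ 0.08` it is false. [cite: Enflo2023, v2 pp.8–9, Lemma 1, eq. (24)] -/
theorem readingA_printed_needs_large_eps0 {e0 : ℝ} (hsmall : e0 ≤ 0.08) :
    (1 / 10 ^ 5) * e0 * (1 - 1 / 10 ^ 20) < 1e14 * ((Real.sqrt 3 / 2) * (1 / 10 ^ 20)) := by
  obtain ⟨hl, hu⟩ := sqrt3_half_bounds
  nlinarith

/-- READING (B) (the paper's own `‖T*u₁‖ < (εθ)_0`, tex:L263): `G·(1 − 10^{-20}) = (√3/2)(εθ)_0` — `(εθ)_0` cancels and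
Lemma 1's comparison FAILS for every `(εθ)_0 > 0` and every `δ ≥ 0`. [cite: Enflo2023, v2 pp.8–9, Lemma 1, eq. (24)] -/
theorem readingB_fails {e0 δ : ℝ} (he0 : 0 < e0) (hδ0 : 0 ≤ δ) :
    (1 / 10 ^ 5) * e0 * (1 - 1 / 10 ^ 20) < Real.exp 20 * (1 + δ) * ((Real.sqrt 3 / 2) * e0) := by
  have h := exp20_sqrt3half_gt
  have h1 : (1 / 10 ^ 5) * (1 - 1 / 10 ^ 20) < Real.exp 20 * (Real.sqrt 3 / 2) * (1 + δ) := by nlinarith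
  have h2 := mul_lt_mul_of_pos_right h1 he0
  nlinarith

/-- READING (C) (referee's `‖T*u₁‖ ≤ 10^{-19}(εθ)_0`): `G·(1 − 10^{-20}) = (√3/2)10^{-19}(εθ)_0` — the comparison SUCCEEDS for
every `(εθ)_0 > 0` and every `0 ≤ δ ≤ 10^{-3}`: Lemma 1 is repaired. [cite: Enflo2023, v2 pp.8–9, Lemma 1, eq. (24)] -/
theorem readingC_succeeds {e0 δ : ℝ} (he0 : 0 < e0) (hδ0 : 0 ≤ δ) (hδ1 : δ ≤ 1 / 10 ^ 3) :
    Real.exp 20 * (1 + δ) * ((Real.sqrt 3 / 2) * ((1 / 10 ^ 19) * e0))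
      < (1 / 10 ^ 5) * e0 * (1 - 1 / 10 ^ 20) := by
  have h := exp20_sqrt3half_lt
  have hpos : 0 < Real.exp 20 * (Real.sqrt 3 / 2) := by linarith [exp20_sqrt3half_gt]
  have h3 : (Real.exp 20 * (Real.sqrt 3 / 2)) * (1 + δ) ≤ 4.209e8 * (1 + 1 / 10 ^ 3) :=
    mul_le_mul h.le (by linarith) (by linarith) (by norm_num)
  have h4 : (Real.exp 20 * (Real.sqrt 3 / 2)) * (1 + δ) * (1 / 10 ^ 19) < (1 / 10 ^ 5) * (1 - 1 / 10 ^ 20) := by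
    nlinarith
  have h5 := mul_lt_mul_of_pos_right h4 he0
  nlinarith

/-- The printed inference of (24), as a bare implication between the displayed quantities under reading (A) (the only bound
on `⟨T^j y'₀, u₁⟩` available from `‖T‖ = 10^{-20}`, `‖y'₀‖ = √3/2`), is FALSE: `(εθ)_0 = 10^{-4}`, all tail mass on `j = 1`,
`|a₁| = 1.2·10^{11}`: then `|a₁|·(√3/2)10^{-20} ≥ 10^{-5}(εθ)_0` holds but `|a₁| < 10^{14}`. [cite: Enflo2023, v2 pp.8–9, Lemma 1, eq. (24)] -/
theorem printed_eq24_inference_false :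
    ¬ ∀ (e0 M : ℝ), 0 < e0 → e0 ≤ 1 / 10 ^ 4 → (1 / 10 ^ 5) * e0 ≤ M * (Real.sqrt 3 / 2 * (1 / 10 ^ 20)) → 1e14 ≤ M := by
  obtain ⟨hl, hu⟩ := sqrt3_half_bounds
  intro h
  have := h (1 / 10 ^ 4) 1.2e11 (by norm_num) (by norm_num) (by nlinarith)
  norm_num at this

end Lemma1

end Literature.Analysis.OperatorTheory.Enflo2023

end
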